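import Mathlib
import HarnessLib
import Literature.NumberTheory.Sieve.BatemanHorn
import Summits.Parity.BatemanHorn.Theses.AlmostPrimeZeros
import Summits.Parity.BatemanHorn.Theorems.AlmostPrimeZerosHadamardBookkeeping
import Summits.Parity.BatemanHorn.Theorems.AlmostPrimeZerosSystemMertens
import Summits.Parity.BatemanHorn.Theorems.AlmostPrimeZerosDeficitFromRepulsion

/-!
# The parity content of `SystemZeroRepulsion`: Liouville-type cancellation along the system

Crux stmt-Parity-11291 (`Summit.Parity.BatemanHorn.Theses.AlmostPrimeZeros.SystemZeroRepulsion`), line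
`euler-species-factorisation` (seat b), lead's necessity note — kernel-checked form of the route's own
"why it might fail: Parity-complete on the negative axis".

For an exponent sequence `e` and `P = Σ_{n ≤ x} X^{e(n)}` (so `P(1) = x+1`, `P′(1) = Σ e(n)`), the landed Hadamard
bookkeeping (`Summit.Parity.BatemanHorn.Theorems.hadamardBookkeeping_proof`, item stmt-Parity-8827) at `z = −1` reads
`|Σ_{n ≤ x} (−1)^{e(n)}| = |P(−1)| ≤ (x+1)·exp(−2·mean(e) + 2·T(P))`, `T(P) = Σ_ρ ‖1−ρ‖⁻²`
(`norm_sum_neg_one_pow_le`).  With `e = s_f` (the capped statistic of a Bateman–Horn system), the landed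
`SystemMertens` (`Summit.Parity.BatemanHorn.Theorems.SystemMertens_proof`, item stmt-Parity-11293: mean `≥ k log log x − C_M`)
and the crux (`T ≤ C_T`) give

  `SystemZeroRepulsion → ∀ BH systems f, ∃ C, ∀ x ≥ 2: |Σ_{n ≤ x} (−1)^{s_f(n)}| ≤ C·(x+1)/(log x)^{2k}`

(`stub_liouvilleSaving`, registered stub of the crux item).  Here `(−1)^{s_f(n)} = ∏_i g(f_i(n))` for the completely determined
multiplicative `g` with `g(p) = −1`, `g(p^v) = +1` (`v ≥ 2`), which agrees with the Liouville function on primes: for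
`f = X² + 1` the conclusion is a Chowla-type statement along `n² + 1` with a `(log x)²` saving (even `o(x)` is open), and for
`f = (X, X+2)` a two-point correlation bound `Σ_n g(n)g(n+2) ≪ x/(log x)⁴` (the un-averaged two-point Chowla conjecture is
open).  So every proof of the crux proves these; this file records the implication, it does not advance it.
-/

namespace Summit.Parity.BatemanHorn.Cruxes.SystemZeroRepulsion.EulerSpeciesFactorisation

open Polynomial Finset
open Summit.Parity.BatemanHorn.Theses.AlmostPrimeZeros

/-- **Hadamard bookkeeping at `z = −1` for an exponent polynomial.** For `P = Σ_{n ≤ x} X^{e(n)} ∈ ℂ[X]`: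
`‖Σ_{n ≤ x} (−1)^{e(n)}‖ ≤ (x+1) · exp(−2·(Σ_n e(n))/(x+1) + 2·Σ_ρ ‖1−ρ‖⁻²)` (roots of `P` with multiplicity):
the landed `hadamardBookkeeping_proof` at `z = −1`, with `P(1) = x+1`, `P′(1) = Σ e(n)`, `‖1 − (−1)‖² = 4`. -/
theorem norm_sum_neg_one_pow_le (e : ℕ → ℕ) (x : ℕ) :
    ‖∑ n ∈ Finset.range (x + 1), (-1 : ℂ) ^ (e n)‖ ≤
      ((x : ℝ) + 1) * Real.exp (-(2 * ((∑ n ∈ Finset.range (x + 1), (e n : ℝ)) / ((x : ℝ) + 1))) +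
        2 * ((∑ n ∈ Finset.range (x + 1), (Polynomial.X : Polynomial ℂ) ^ (e n)).roots.map
          (fun ρ : ℂ => (‖(1 : ℂ) - ρ‖ ^ 2)⁻¹)).sum) := by
  set P : ℂ[X] := ∑ n ∈ Finset.range (x + 1), (X : ℂ[X]) ^ (e n) with hP
  have hP1 : P.eval 1 = (x : ℂ) + 1 := Summit.Parity.BatemanHorn.Theorems.eval_one_sum_X_pow e x
  have hN : ((x : ℂ) + 1) ≠ 0 := by exact_mod_cast Nat.succ_ne_zero x
  have hP1ne : P.eval 1 ≠ 0 := by rw [hP1]; exact hN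
  have h := Summit.Parity.BatemanHorn.Theorems.hadamardBookkeeping_proof P hP1ne (-1)
  have hevm1 : P.eval (-1) = ∑ n ∈ Finset.range (x + 1), (-1 : ℂ) ^ (e n) := by
    simp [hP, eval_finsetSum]
  have hder : (derivative P).eval 1 = ∑ n ∈ Finset.range (x + 1), (e n : ℂ) :=
    Summit.Parity.BatemanHorn.Theorems.eval_one_derivative_sum_X_pow e x
  have hnorm1 : ‖P.eval 1‖ = (x : ℝ) + 1 := by
    rw [hP1]
    have : ((x : ℂ) + 1) = (((x : ℝ) + 1 : ℝ) : ℂ) := by push_cast; ring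
    rw [this, Complex.norm_real, Real.norm_eq_abs, abs_of_nonneg (by positivity)]
  have hre : (((1 : ℂ) - (-1)) * ((∑ n ∈ Finset.range (x + 1), (e n : ℂ)) / ((x : ℂ) + 1))).re =
      2 * ((∑ n ∈ Finset.range (x + 1), (e n : ℝ)) / ((x : ℝ) + 1)) := by
    have : ((1 : ℂ) - (-1)) * ((∑ n ∈ Finset.range (x + 1), (e n : ℂ)) / ((x : ℂ) + 1)) =
        ((2 * ((∑ n ∈ Finset.range (x + 1), (e n : ℝ)) / ((x : ℝ) + 1)) : ℝ) : ℂ) := by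
      push_cast
      ring
    rw [this, Complex.ofReal_re]
  have htwo : (1 / 2 : ℝ) * ‖(1 : ℂ) - (-1)‖ ^ 2 = 2 := by
    have h2 : (1 : ℂ) - (-1) = (2 : ℝ) := by push_cast; ring
    rw [h2, Complex.norm_real, Real.norm_eq_abs, abs_of_pos (by norm_num : (0 : ℝ) < 2)]
    norm_num
  rw [hevm1, hnorm1, hder, hP1, hre, htwo] at h
  exact h

/-- **The parity content of the crux (necessity, kernel-checked).** `SystemZeroRepulsion` implies, for every
Bateman–Horn system `f = (f_1,…,f_k)`, a Liouville-type cancellation along `f` with a `(log x)^{2k}` saving: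
`|Σ_{n ≤ x} (−1)^{s_f(n)}| ≤ C_f (x+1)/(log x)^{2k}` for all `x ≥ 2`, where `s_f(n) = Σ_i Σ_{p^v ∥ f_i(n)} min(v,2)` and
`(−1)^{s_f(n)} = ∏_i g(f_i(n))`, `g(p) = −1`, `g(p^v) = 1` (`v ≥ 2`).  Proof: `norm_sum_neg_one_pow_le` with the landed
`SystemMertens_proof` (mean of `s_f` is `≥ k log log x − C_M`) and the crux's `T_f(x) ≤ C_T`; constant `C_f = e^{2C_M + 2C_T}`.
For `deg f ≥ 2` or `k ≥ 2` the conclusion is an open Chowla-type statement (one-point along `f`, resp. multi-point), which is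
why the crux is labelled open-problem: every proof of it proves these. -/
theorem stub_liouvilleSaving :
    Summit.Parity.BatemanHorn.Theses.AlmostPrimeZeros.SystemZeroRepulsion →
      ∀ (k : ℕ) (f : Fin k → Polynomial ℤ), Literature.NumberTheory.Sieve.IsBatemanHornSystem f →
        ∃ C : ℝ, ∀ x : ℕ, 2 ≤ x →
          ‖∑ n ∈ Finset.range (x + 1),
              (-1 : ℂ) ^ (∑ i, (((f i).eval (n : ℤ)).toNat.factorization.sum fun _ v => min v 2))‖ ≤
            C * ((x : ℝ) + 1) / (Real.log (x : ℝ)) ^ (2 * k) := by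
  intro hZ k f hf
  obtain ⟨CT, hT⟩ := hZ k f hf
  obtain ⟨CM, hM⟩ := Summit.Parity.BatemanHorn.Theorems.SystemMertens_proof k f hf
  refine ⟨Real.exp (2 * CM + 2 * CT), fun x hx => ?_⟩
  have hx1 : (1 : ℝ) < x := by exact_mod_cast hx
  have hlogpos : 0 < Real.log (x : ℝ) := Real.log_pos hx1
  have hTx := hT x hx
  have hMx := hM x hx
  have h0 := norm_sum_neg_one_pow_le
    (fun n => ∑ i, (((f i).eval (n : ℤ)).toNat.factorization.sum fun _ v => min v 2)) x
  -- the mean of `s_f` is at least `k log log x − C_M`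
  have hlow : (k : ℝ) * Real.log (Real.log (x : ℝ)) - CM ≤
      (∑ n ∈ Finset.range (x + 1),
        ((∑ i, (((f i).eval (n : ℤ)).toNat.factorization.sum fun _ v => min v 2) : ℕ) : ℝ)) /
          ((x : ℝ) + 1) := by
    have h1 := (abs_le.mp hMx).1
    push_cast [Nat.cast_sum] at h1 ⊢
    linarith
  -- `(log x)^{2k} = exp (2k · log log x)`
  have hpow : Real.exp (2 * (k : ℝ) * Real.log (Real.log (x : ℝ))) = Real.log (x : ℝ) ^ (2 * k) := by
    rw [show 2 * (k : ℝ) * Real.log (Real.log (x : ℝ)) = ((2 * k : ℕ) : ℝ) * Real.log (Real.log (x : ℝ)) by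
      push_cast; ring, Real.exp_nat_mul, Real.exp_log hlogpos]
  have hpowpos : 0 < Real.log (x : ℝ) ^ (2 * k) := pow_pos hlogpos _
  rw [le_div_iff₀ hpowpos]
  calc ‖∑ n ∈ Finset.range (x + 1),
          (-1 : ℂ) ^ (∑ i, (((f i).eval (n : ℤ)).toNat.factorization.sum fun _ v => min v 2))‖ *
          Real.log (x : ℝ) ^ (2 * k)
      ≤ ((x : ℝ) + 1) * Real.exp (-(2 * ((∑ n ∈ Finset.range (x + 1),
            ((∑ i, (((f i).eval (n : ℤ)).toNat.factorization.sum fun _ v => min v 2) : ℕ) : ℝ)) /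
              ((x : ℝ) + 1))) + 2 * CT) * Real.log (x : ℝ) ^ (2 * k) := by
        gcongr ?_ * _
        refine h0.trans ?_
        gcongr
    _ ≤ ((x : ℝ) + 1) * Real.exp (-(2 * ((k : ℝ) * Real.log (Real.log (x : ℝ)) - CM)) + 2 * CT) *
          Real.log (x : ℝ) ^ (2 * k) := by
        gcongr
    _ = Real.exp (2 * CM + 2 * CT) * ((x : ℝ) + 1) := by
        rw [show -(2 * ((k : ℝ) * Real.log (Real.log (x : ℝ)) - CM)) + 2 * CT =
            (2 * CM + 2 * CT) + -(2 * (k : ℝ) * Real.log (Real.log (x : ℝ))) by ring,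
          Real.exp_add, Real.exp_neg, hpow]
        field_simp

end Summit.Parity.BatemanHorn.Cruxes.SystemZeroRepulsion.EulerSpeciesFactorisation
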